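import Mathlib

/-!
# Winding relations in all-X designs (Lemma W of `Cruxes/PeelingLemma/REFEREE-ref1.md`, Addendum B)

Negative knowledge supporting `stmt-ValiantsHypothesis-7391` (`BinomialElusive.PeelingLemma`).  In the vector form of an
all-X design (`AllXDesignsExist`, this directory) output `i` joins vertices `V i`, `W i` and has pair labels
`ψ (V i) + ψ (W i) = e_{A i} + e_{B i}` and `ψ' (V i) + ψ' (W i) = e_{C i} + e_{D i}`; its two output vectors are
`o₁ i = ψ (V i) + ψ' (W i)` and `o₂ i = ψ' (V i) + ψ (W i)`, so `o₁ i + o₂ i = π i + π' i` is the sum of the two labels.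

* `relation_of_label_sums_eq_zero` : if an integer edge weighting `w` kills both label sums, `(w, w)` is a relation.
* `alternatingSum_pair_chain_eq_zero` : the alternating sum of the pair vectors `e_{λ j} + e_{λ (j+1)}` along a CLOSED
  chain of letters `λ 0, …, λ (2k) = λ 0` vanishes (telescoping).
* `relation_of_closed_label_chains` : hence `2k` outputs whose labels form a closed chain of even length in BOTH alphabets
  carry the relation `u = v = (-1)^j` — the "winding relations" that kill every alphabet-symmetric FIFO / Θ-gadget
  all-X design as written (certificates: item evidence `WINDING-CERTIFICATES.txt`).
-/

set_option linter.dupNamespace false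

namespace Summit.ValiantsHypothesis.ValiantsHypothesis.Theorems.PeelingLemmaNegative

open Finset

/-- If an edge weighting `w` annihilates the label sums of both alphabets, then `(u, v) = (w, w)` annihilates the
outputs: `Σ_i (w_i • o₁ i + w_i • o₂ i) = 0`. -/
theorem relation_of_label_sums_eq_zero {m n s : ℕ} (ψ ψ' : Fin n → Fin s → ℤ) (V W : Fin m → Fin n)
    (A B C D : Fin m → Fin s)
    (hAB : ∀ i, ψ (V i) + ψ (W i) = Pi.single (A i) 1 + Pi.single (B i) 1)
    (hCD : ∀ i, ψ' (V i) + ψ' (W i) = Pi.single (C i) 1 + Pi.single (D i) 1)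
    (w : Fin m → ℤ)
    (h₁ : ∑ i, w i • (Pi.single (A i) (1 : ℤ) + Pi.single (B i) 1 : Fin s → ℤ) = 0)
    (h₂ : ∑ i, w i • (Pi.single (C i) (1 : ℤ) + Pi.single (D i) 1 : Fin s → ℤ) = 0) :
    ∑ i, (w i • (ψ (V i) + ψ' (W i)) + w i • (ψ' (V i) + ψ (W i))) = 0 := by
  have key : ∀ i, w i • (ψ (V i) + ψ' (W i)) + w i • (ψ' (V i) + ψ (W i))
      = w i • (Pi.single (A i) (1 : ℤ) + Pi.single (B i) 1 : Fin s → ℤ)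
        + w i • (Pi.single (C i) (1 : ℤ) + Pi.single (D i) 1 : Fin s → ℤ) := by
    intro i
    rw [← hAB i, ← hCD i, ← smul_add, ← smul_add]
    congr 1
    abel
  simp_rw [key, sum_add_distrib, h₁, h₂, add_zero]

/-- Telescoping along a closed chain of letters: `Σ_{j<2k} (-1)^j (e_{λ j} + e_{λ (j+1)}) = 0` when `λ (2k) = λ 0`. -/
theorem alternatingSum_pair_chain_eq_zero {s : ℕ} (k : ℕ) (lam : ℕ → Fin s) (hper : lam (2 * k) = lam 0) :
    ∑ j ∈ range (2 * k), (-1 : ℤ) ^ j • (Pi.single (lam j) (1 : ℤ) + Pi.single (lam (j + 1)) 1 : Fin s → ℤ)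
      = 0 := by
  have h : ∀ j, (-1 : ℤ) ^ j • (Pi.single (lam j) (1 : ℤ) + Pi.single (lam (j + 1)) 1 : Fin s → ℤ)
      = (-1 : ℤ) ^ j • (Pi.single (lam j) (1 : ℤ) : Fin s → ℤ)
        - (-1 : ℤ) ^ (j + 1) • (Pi.single (lam (j + 1)) (1 : ℤ) : Fin s → ℤ) := by
    intro j
    rw [smul_add, pow_succ, mul_neg_one, neg_smul, sub_neg_eq_add]
  simp_rw [h]
  rw [sum_range_sub', hper, pow_mul, neg_one_sq, one_pow, pow_zero, sub_self]

/-- **Winding relations.**  Let `e : ℕ → Fin m` list `2k` DISTINCT outputs whose alphabet-1 labels form a closed chain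
`{A (e j), B (e j)} = {λ j, λ (j+1)}` (as pair vectors) with `λ (2k) = λ 0`, and whose alphabet-2 labels form a closed
chain `μ` likewise.  Then `u = v = (-1)^j` on `e j` (zero elsewhere) is a nonzero relation of the design of cost `4k`:
here we record the vanishing `Σ_i (u_i • o₁ i + u_i • o₂ i) = 0` for the weighting
`u = Σ_j (-1)^j [· = e j]`. -/
theorem relation_of_closed_label_chains {m n s : ℕ} (ψ ψ' : Fin n → Fin s → ℤ) (V W : Fin m → Fin n)
    (A B C D : Fin m → Fin s)
    (hAB : ∀ i, ψ (V i) + ψ (W i) = Pi.single (A i) 1 + Pi.single (B i) 1)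
    (hCD : ∀ i, ψ' (V i) + ψ' (W i) = Pi.single (C i) 1 + Pi.single (D i) 1)
    (k : ℕ) (e : ℕ → Fin m) (lam mu : ℕ → Fin s) (hlam : lam (2 * k) = lam 0) (hmu : mu (2 * k) = mu 0)
    (hchain₁ : ∀ j < 2 * k, (Pi.single (A (e j)) (1 : ℤ) + Pi.single (B (e j)) 1 : Fin s → ℤ)
        = Pi.single (lam j) 1 + Pi.single (lam (j + 1)) 1)
    (hchain₂ : ∀ j < 2 * k, (Pi.single (C (e j)) (1 : ℤ) + Pi.single (D (e j)) 1 : Fin s → ℤ)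
        = Pi.single (mu j) 1 + Pi.single (mu (j + 1)) 1) :
    let u : Fin m → ℤ := fun i => ∑ j ∈ range (2 * k), if e j = i then (-1 : ℤ) ^ j else 0
    ∑ i, (u i • (ψ (V i) + ψ' (W i)) + u i • (ψ' (V i) + ψ (W i))) = 0 := by
  intro u
  -- push the edge weighting `u` through to label sums and use the two telescoping identities
  have push : ∀ (P Q : Fin m → Fin s),
      ∑ i, u i • (Pi.single (P i) (1 : ℤ) + Pi.single (Q i) 1 : Fin s → ℤ)
        = ∑ j ∈ range (2 * k),
            (-1 : ℤ) ^ j • (Pi.single (P (e j)) (1 : ℤ) + Pi.single (Q (e j)) 1 : Fin s → ℤ) := by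
    intro P Q
    simp only [u, sum_smul, ite_smul, zero_smul]
    rw [sum_comm]
    refine sum_congr rfl fun j _ => ?_
    rw [sum_ite_eq univ (e j)]
    simp
  refine relation_of_label_sums_eq_zero ψ ψ' V W A B C D hAB hCD u ?_ ?_
  · rw [push A B, ← alternatingSum_pair_chain_eq_zero k lam hlam]
    exact sum_congr rfl fun j hj => by rw [hchain₁ j (mem_range.mp hj)]
  · rw [push C D, ← alternatingSum_pair_chain_eq_zero k mu hmu]
    exact sum_congr rfl fun j hj => by rw [hchain₂ j (mem_range.mp hj)]

end Summit.ValiantsHypothesis.ValiantsHypothesis.Theorems.PeelingLemmaNegative
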